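import Mathlib
import HarnessLib
import Summits.HubbardSuperconductivity.HubbardSuperconductivity.Theorems.KLProgrammeKLRegimeEngineLatticeShellAsymmetry
import Summits.HubbardSuperconductivity.HubbardSuperconductivity.Theorems.KLProgrammeC4aLevelDensityRadial

/-!
# Route `KLProgramme` — ENGINE (stmt-HubbardSuperconductivity-20437 `KLRegimeEngineV17F2`), cure (C′) of located #22, brick O3 part 3:
# the CONTINUUM shell volumes of the frame band in level coordinates — `vol{e_K ∈ I} = ∫_I N_K`, thin shells `≤ 2π·J_max·|I|`,
# two-sided asymmetry `≤ 4π·jacR·Λ²` — and THE LATTICE SHELL ASYMMETRY OF THE FRAME BAND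
# (cell gate-hubbard-kl, seat hubbard-kl-k3c2-p2 g31, technique «thermal-bar induction n ≤ nScales β + 1 with EngineBoundsAtV4S sums»)

WHY.  Brick O2 (`klol_abs_sum_odd_le`) reduces the localised born sum of binder #9's self-energy line to the two-sided shell asymmetry
`#{k̃ : t < e_K(p_k̃) ≤ Λ} − #{k̃ : −Λ ≤ e_K(p_k̃) < −t}`; part 2 (`abs_card_sub_card_shell_le_of_volumes`) bounds it by `(L/2π)²·(A_c + 4·D·δ)` given
thin-shell volumes `≤ D·width` and the CONTINUUM asymmetry `≤ A_c`.  This file supplies both for the frame band `e_K = ε₀ − K − μ` from the co-moving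
chart of the C4a lineage (`setIntegral_tube_eq_chart`: the tube integral IS the chart integral against `J = u·∂_ρu`; `abs_levelDensity_sub_neg_le`:
`|N_K(ρ) − N_K(−ρ)| ≤ 4π·jacR·|ρ|`), under that lineage's standing hypotheses (`B : BandBounds a b`, frame of `C²` size `A`, `2A < Dt_min`, tube
`(−r, r)` with `[μ − r − A, μ + r + A] ⊂ (a, b)`):
* §1 `integrableOn_levelChartJac_box`, **`volume_openSq_levelSet_eq_integral_levelDensity`** — for a measurable `I ⊆ (−r, r)`:
  `vol{q ∈ (−π,π)² : e_K(q) ∈ I} = ∫_{ρ ∈ I} N_K(ρ) dρ`, `N_K(ρ) = ∫_{(0,2π]} J(ρ,ϑ) dϑ` (layer cake in level coordinates);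
* §2 `integral_levelDensity_le` (`∫_{[a′,b′]} N_K ≤ 2π·(π√2/(Dt_min − 2A))·(b′ − a′)`, from `levelChartJac_le`) and
  `abs_integral_levelDensity_Ioc_sub_Ico_le` (`|∫_{(t,Λ]} N_K − ∫_{[−Λ,−t)} N_K| ≤ 4π·jacR·Λ·(Λ − t)`, `0 ≤ t ≤ Λ < r`);
* §3 the planar band on `ℝ²`: continuity, double `2π`-periodicity, cell oscillation `≤ (4 + 2A)·2π/L`, `[0,2π)²`-level-set volumes (part 2 §4);
* §4 **`abs_card_sub_card_frameShell_le`** — THE GEO BRICK O3: for `0 ≤ Λ`, `Λ + (4 + 2A)·2π/L < r`, `t ∈ [0, Λ]`: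
  `|#{t < e_K(p_k̃) ≤ Λ} − #{−Λ ≤ e_K(p_k̃) < −t}| ≤ (L/2π)²·(4π·jacR·Λ² + 4·(2π·π√2/(Dt_min − 2A))·(4 + 2A)·2π/L)`, i.e. `c₁Λ²L² + c₂L` with
  `c₁ = jacR/π ≤ 11`, `c₂ ≤ 440` on `klWindowC` (`jacR ≤ 34`, `jacRadialConst_le_of_Dtmin_tableA`) — CURE-C-PRIME-DESIGN §3's shape.
Pure analysis on the tree's objects; no definitions; nothing asserts (c), K3 or superconductivity.
References: BGM 2006 §2.4 Lemma 2.1 (2.40)–(2.41) [cite: BenfattoGiulianiMastropietro2006]; FST II CPAM 51 (1998) 1133, App. B [cite: FeldmanSalmhoferTrubowitz1998].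
-/

noncomputable section

namespace Summit.HubbardSuperconductivity.HubbardSuperconductivity.Theorems.EngineV8

set_option linter.dupNamespace false -- summit = problem name (single-conjunct summit), D-0017

open Real Set MeasureTheory Finset
open scoped ENNReal
open Literature.MathematicalPhysics.QuantumLattice Literature.MathematicalPhysics.QuantumLattice.BandSectorCounting
open Literature.Probability.LatticeModels
open Summit.HubbardSuperconductivity.HubbardSuperconductivity.Theorems.DispersionFlow
open Summit.HubbardSuperconductivity.HubbardSuperconductivity.Theorems.KLRegimeSplit
open Summit.HubbardSuperconductivity.HubbardSuperconductivity.Theorems.PerturbedFermiCurve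
open Summit.HubbardSuperconductivity.HubbardSuperconductivity.Theorems.C4a

section Chart

variable {a b : ℝ} (B : BandBounds a b) {K : TrigPolyC4v} {A : ℝ}
  (hA : ∀ p : Momentum, ∀ j ≤ 2, ‖iteratedFDeriv ℝ j (frameShift K) p‖ ≤ A) (hADt : 2 * A < B.Dtmin)
  {μ r : ℝ} (hlo : a < μ - r - A) (hhi : μ + r + A < b)
include B hA hADt hlo hhi

/-! ## §1 The chart Jacobian on the box; level-set volumes are integrals of the level density -/

/-- On the chart box `(−r, r) × ℝ` the Jacobian weight satisfies `0 ≤ J ≤ π√2/(Dt_min − 2A)`. -/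
theorem levelChartJac_nonneg_le {p : ℝ × ℝ} (hp : p.1 ∈ Ioo (-r) r) :
    0 ≤ levelChartJac μ K p ∧ levelChartJac μ K p ≤ π * Real.sqrt 2 / (B.Dtmin - 2 * A) := by
  have h1 : a < μ + p.1 - A := by linarith [hp.1]
  have h2 : μ + p.1 + A < b := by linarith [hp.2]
  rw [levelChartJac_apply]
  exact ⟨(levelChartJac_pos B hA hADt h1 h2).le, levelChartJac_le B hA hADt h1 h2⟩

/-- **The Jacobian weight is integrable on every measurable part of the chart box `(−r, r) × (s, t]`** (continuous on the open tube, bounded). -/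
theorem integrableOn_levelChartJac_box {S : Set (ℝ × ℝ)} (hS : MeasurableSet S) {s t : ℝ} (hSsub : S ⊆ Ioo (-r) r ×ˢ Ioc s t) :
    IntegrableOn (levelChartJac μ K) S := by
  have hcont : ContinuousOn (levelChartJac μ K) S :=
    (contDiffOn_levelChartJac B hA hADt hlo hhi).continuousOn.mono fun p hp =>
      mk_mem_prod (abs_lt.2 ⟨(mem_prod.1 (hSsub hp)).1.1, (mem_prod.1 (hSsub hp)).1.2⟩) (mem_univ _)
  have hfin : volume S < ∞ :=
    (measure_mono hSsub).trans_lt (by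
      rw [Measure.volume_eq_prod, Measure.prod_prod, Real.volume_Ioo, Real.volume_Ioc]
      exact ENNReal.mul_lt_top ENNReal.ofReal_lt_top ENNReal.ofReal_lt_top)
  refine IntegrableOn.of_bound hfin (hcont.aestronglyMeasurable hS) (π * Real.sqrt 2 / (B.Dtmin - 2 * A))
    (ae_restrict_of_forall_mem hS fun p hp => ?_)
  have h := levelChartJac_nonneg_le B hA hADt hlo hhi (mem_prod.1 (hSsub hp)).1
  rw [Real.norm_eq_abs, abs_of_nonneg h.1]
  exact h.2

/-- **LEVEL SETS OF THE OPEN SQUARE IN LEVEL COORDINATES (layer cake through the co-moving chart)**: for a measurable `I ⊆ (−r, r)`,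
`vol{q : |q₁| < π, |q₂| < π, e_K(q) ∈ I} = ∫_{ρ ∈ I} N_K(ρ) dρ`, `N_K(ρ) = ∫_{ϑ ∈ (0,2π]} J(ρ,ϑ) dϑ`. [cite: BenfattoGiulianiMastropietro2006, §2.4 (2.40)] -/
theorem volume_openSq_levelSet_eq_integral_levelDensity {I : Set ℝ} (hI : MeasurableSet I) (hIr : I ⊆ Ioo (-r) r) :
    volume {q : ℝ × ℝ | |q.1| < π ∧ |q.2| < π ∧ frameLevel μ K (WithLp.toLp 2 ![q.1, q.2]) ∈ I} =
      ENNReal.ofReal (∫ ρ in I, ∫ ϑ in Ioc 0 (2 * π), levelChartJac μ K (ρ, ϑ)) := by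
  classical
  have hπ := Real.pi_pos
  set e : ℝ × ℝ → ℝ := fun q => frameLevel μ K (WithLp.toLp 2 ![q.1, q.2]) with hedef
  set T : Set (ℝ × ℝ) := {q : ℝ × ℝ | |q.1| < π ∧ |q.2| < π ∧ |e q| < r} with hTdef
  set S : Set (ℝ × ℝ) := {q : ℝ × ℝ | |q.1| < π ∧ |q.2| < π ∧ e q ∈ I} with hSdef
  have hvec : Continuous fun x : ℝ × ℝ => (![x.1, x.2] : Fin 2 → ℝ) := by
    refine continuous_pi fun i => ?_
    fin_cases i
    · simpa using continuous_fst
    · simpa using continuous_snd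
  have hec : Continuous e := (contDiff_frameLevel μ K (n := 0)).continuous.comp ((PiLp.continuous_toLp 2 _).comp hvec)
  have hem : Measurable e := hec.measurable
  have hopen : MeasurableSet {q : ℝ × ℝ | |q.1| < π ∧ |q.2| < π} :=
    ((measurableSet_lt continuous_fst.abs.measurable measurable_const).inter
      (measurableSet_lt continuous_snd.abs.measurable measurable_const))
  have hSm : MeasurableSet S := by
    have : S = {q : ℝ × ℝ | |q.1| < π ∧ |q.2| < π} ∩ e ⁻¹' I := by
      ext q; simp only [hSdef, Set.mem_setOf_eq, Set.mem_inter_iff, Set.mem_preimage, and_assoc]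
    rw [this]; exact hopen.inter (hem hI)
  have hST : S ⊆ T := fun q hq => ⟨hq.1, hq.2.1, abs_lt.2 ⟨(hIr hq.2.2).1, (hIr hq.2.2).2⟩⟩
  have hSfin : volume S < ∞ := by
    refine (measure_mono (fun q hq => ?_ : S ⊆ Ioo (-π) π ×ˢ Ioo (-π) π)).trans_lt ?_
    · exact mk_mem_prod (abs_lt.1 hq.1) (abs_lt.1 hq.2.1)
    · rw [Measure.volume_eq_prod, Measure.prod_prod, Real.volume_Ioo]
      exact ENNReal.mul_lt_top ENNReal.ofReal_lt_top ENNReal.ofReal_lt_top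
  have h1 : (volume S).toReal = ∫ q in T, I.indicator (fun _ => (1 : ℝ)) (e q) := by
    have hind : (fun q => I.indicator (fun _ => (1 : ℝ)) (e q)) = (e ⁻¹' I).indicator fun _ => (1 : ℝ) := by
      funext q; simp only [Set.indicator_apply, Set.mem_preimage]
    rw [hind, setIntegral_indicator (hem hI), setIntegral_const, smul_eq_mul, mul_one, measureReal_def]
    congr 2
    ext q
    simp only [hTdef, hSdef, Set.mem_inter_iff, Set.mem_setOf_eq, Set.mem_preimage]
    constructor
    · rintro ⟨h1, h2, h3⟩; exact ⟨⟨h1, h2, abs_lt.2 ⟨(hIr h3).1, (hIr h3).2⟩⟩, h3⟩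
    · rintro ⟨⟨h1, h2, _⟩, h3⟩; exact ⟨h1, h2, h3⟩
  have h2 : ∫ q in T, I.indicator (fun _ => (1 : ℝ)) (e q) =
      ∫ p in Ioo (-r) r ×ˢ Ioc (-π) π, levelChartJac μ K p * I.indicator (fun _ => (1 : ℝ)) p.1 := by
    rw [hTdef, hedef, setIntegral_tube_eq_chart B hA hADt hlo hhi]
    refine setIntegral_congr_fun (measurableSet_Ioo.prod measurableSet_Ioc) fun p hp => ?_
    have hp1 : p.1 ∈ Ioo (-r) r := (mem_prod.1 hp).1
    have h1' : a ≤ μ + p.1 - A := by linarith [hp1.1]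
    have h2' : μ + p.1 + A ≤ b := by linarith [hp1.2]
    simp only [smul_eq_mul]
    rw [toLp_vec_levelChart, frameLevel_levelPoint B hA h1' h2', ← levelChartJac_apply]
  have hper : ∀ ρ, Function.Periodic (fun ϑ => levelChartJac μ K (ρ, ϑ) * I.indicator (fun _ => (1 : ℝ)) (ρ, ϑ).1) (2 * π) := by
    intro ρ ϑ
    simp only [levelChartJac_periodic μ K ρ ϑ]
  have hKint : ∀ s t : ℝ, IntegrableOn (fun p : ℝ × ℝ => levelChartJac μ K p * I.indicator (fun _ => (1 : ℝ)) p.1)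
      (Ioo (-r) r ×ˢ Ioc s t) := by
    intro s t
    have hJ := integrableOn_levelChartJac_box B hA hADt hlo hhi (measurableSet_Ioo.prod measurableSet_Ioc) (subset_refl (Ioo (-r) r ×ˢ Ioc s t))
    refine Integrable.mul_of_top_left hJ ?_  -- bounded measurable second factor
    refine memLp_top_of_bound ((measurable_const.indicator hI).comp measurable_fst).aestronglyMeasurable 1
      (Filter.Eventually.of_forall fun p => ?_)
    by_cases hp : p.1 ∈ I
    · rw [Set.indicator_of_mem hp]; simp
    · rw [Set.indicator_of_notMem hp]; simp
  have h3 : ∫ p in Ioo (-r) r ×ˢ Ioc (-π) π, levelChartJac μ K p * I.indicator (fun _ => (1 : ℝ)) p.1 =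
      ∫ p in Ioo (-r) r ×ˢ Ioc 0 (2 * π), levelChartJac μ K p * I.indicator (fun _ => (1 : ℝ)) p.1 :=
    setIntegral_box_shift_angle hper (hKint _ _) (hKint _ _)
  have h4 : ∫ p in Ioo (-r) r ×ˢ Ioc 0 (2 * π), levelChartJac μ K p * I.indicator (fun _ => (1 : ℝ)) p.1 =
      ∫ p in I ×ˢ Ioc 0 (2 * π), levelChartJac μ K p := by
    have hind : (fun p : ℝ × ℝ => levelChartJac μ K p * I.indicator (fun _ => (1 : ℝ)) p.1) =
        (I ×ˢ (univ : Set ℝ)).indicator (levelChartJac μ K) := by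
      funext p
      simp only [Set.indicator_apply, Set.mem_prod, Set.mem_univ, and_true]
      split_ifs <;> simp
    have hset : (Ioo (-r) r ×ˢ Ioc 0 (2 * π)) ∩ I ×ˢ (univ : Set ℝ) = I ×ˢ Ioc 0 (2 * π) := by
      ext p
      simp only [Set.mem_inter_iff, Set.mem_prod, Set.mem_univ, and_true]
      constructor
      · rintro ⟨⟨_, h2⟩, h3⟩; exact ⟨h3, h2⟩
      · rintro ⟨h3, h2⟩; exact ⟨⟨hIr h3, h2⟩, h3⟩
    rw [hind, setIntegral_indicator (hI.prod MeasurableSet.univ), hset]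
  have h5 : ∫ p in I ×ˢ Ioc 0 (2 * π), levelChartJac μ K p = ∫ ρ in I, ∫ ϑ in Ioc 0 (2 * π), levelChartJac μ K (ρ, ϑ) := by
    rw [Measure.volume_eq_prod, setIntegral_prod]
    rw [← Measure.volume_eq_prod]
    exact integrableOn_levelChartJac_box B hA hADt hlo hhi (hI.prod measurableSet_Ioc) (prod_mono hIr subset_rfl)
  rw [← ENNReal.ofReal_toReal hSfin.ne, h1, h2, h3, h4, h5]

/-! ## §2 Thin shells and the two-sided asymmetry of the level density -/

/-- The level density is bounded: `0 ≤ N_K(ρ) ≤ 2π·(π√2/(Dt_min − 2A))` for `ρ ∈ (−r, r)`. -/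
theorem levelDensity_nonneg_le {ρ : ℝ} (hρ : ρ ∈ Ioo (-r) r) :
    0 ≤ ∫ ϑ in Ioc 0 (2 * π), levelChartJac μ K (ρ, ϑ) ∧
      ∫ ϑ in Ioc 0 (2 * π), levelChartJac μ K (ρ, ϑ) ≤ 2 * π * (π * Real.sqrt 2 / (B.Dtmin - 2 * A)) := by
  have hπ := Real.pi_pos
  have hvol : volume (Ioc 0 (2 * π)) < ⊤ := by rw [Real.volume_Ioc]; exact ENNReal.ofReal_lt_top
  constructor
  · exact setIntegral_nonneg measurableSet_Ioc fun ϑ _ => (levelChartJac_nonneg_le B hA hADt hlo hhi (p := (ρ, ϑ)) hρ).1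
  · have h := norm_setIntegral_le_of_norm_le_const hvol (f := fun ϑ => levelChartJac μ K (ρ, ϑ))
      (C := π * Real.sqrt 2 / (B.Dtmin - 2 * A)) (fun ϑ _ => by
        have h' := levelChartJac_nonneg_le B hA hADt hlo hhi (p := (ρ, ϑ)) hρ
        rw [Real.norm_eq_abs, abs_of_nonneg h'.1]; exact h'.2)
    rw [Real.norm_eq_abs, Real.volume_real_Ioc_of_le (by positivity), sub_zero] at h
    have := le_abs_self (∫ ϑ in Ioc 0 (2 * π), levelChartJac μ K (ρ, ϑ))
    linarith

/-- **Thin shells**: for `[a′, b′] ⊆ (−r, r)` measurable `I ⊆ [a′, b′]`, `∫_I N_K ≤ 2π·(π√2/(Dt_min − 2A))·(b′ − a′)`. -/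
theorem integral_levelDensity_le {I : Set ℝ} {a' b' : ℝ} (hab : a' ≤ b') (hI : I ⊆ Icc a' b') (hIr : Icc a' b' ⊆ Ioo (-r) r) :
    ∫ ρ in I, ∫ ϑ in Ioc 0 (2 * π), levelChartJac μ K (ρ, ϑ) ≤ 2 * π * (π * Real.sqrt 2 / (B.Dtmin - 2 * A)) * (b' - a') := by
  have hvol : volume I < ⊤ := (measure_mono hI).trans_lt (by rw [Real.volume_Icc]; exact ENNReal.ofReal_lt_top)
  have h := norm_setIntegral_le_of_norm_le_const hvol (f := fun ρ => ∫ ϑ in Ioc 0 (2 * π), levelChartJac μ K (ρ, ϑ))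
    (C := 2 * π * (π * Real.sqrt 2 / (B.Dtmin - 2 * A))) (fun ρ hρ => by
      have h' := levelDensity_nonneg_le B hA hADt hlo hhi (hIr (hI hρ))
      rw [Real.norm_eq_abs, abs_of_nonneg h'.1]; exact h'.2)
  rw [Real.norm_eq_abs] at h
  have hreal : volume.real I ≤ b' - a' := by
    rw [measureReal_def]
    refine ENNReal.toReal_le_of_le_ofReal (sub_nonneg.2 hab) ((measure_mono hI).trans ?_)
    rw [Real.volume_Icc]
  have hC : 0 ≤ 2 * π * (π * Real.sqrt 2 / (B.Dtmin - 2 * A)) := by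
    have hd : 0 < B.Dtmin - 2 * A := by linarith
    positivity
  have := le_abs_self (∫ ρ in I, ∫ ϑ in Ioc 0 (2 * π), levelChartJac μ K (ρ, ϑ))
  nlinarith [mul_le_mul_of_nonneg_left hreal hC]

/-- The level density is continuous on `(−r, r)` (it is Lipschitz there, `abs_levelDensity_sub_le`). -/
theorem continuousOn_levelDensity : ContinuousOn (fun ρ => ∫ ϑ in Ioc 0 (2 * π), levelChartJac μ K (ρ, ϑ)) (Ioo (-r) r) := by
  set C := 2 * π * (1 / (B.Dtmin - 2 * A) ^ 2 + Real.pi * Real.sqrt 2 * (2 + 4 * A) / (B.Dtmin - 2 * A) ^ 3) with hC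
  have hlip : ∀ ρ ∈ Ioo (-r) r, ∀ ρ' ∈ Ioo (-r) r,
      dist (∫ ϑ in Ioc 0 (2 * π), levelChartJac μ K (ρ, ϑ)) (∫ ϑ in Ioc 0 (2 * π), levelChartJac μ K (ρ', ϑ)) ≤ |C| * dist ρ ρ' := by
    intro ρ hρ ρ' hρ'
    rw [Real.dist_eq, Real.dist_eq]
    have h := abs_levelDensity_sub_le B hA hADt hlo hhi hρ hρ'
    calc _ ≤ C * |ρ - ρ'| := by rw [hC]; linarith
      _ ≤ |C| * |ρ - ρ'| := mul_le_mul_of_nonneg_right (le_abs_self C) (abs_nonneg _)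
  exact (LipschitzOnWith.of_dist_le_mul (K := ⟨|C|, abs_nonneg C⟩) fun ρ hρ ρ' hρ' => hlip ρ hρ ρ' hρ').continuousOn

/-- **Two-sided asymmetry of the continuum shells**: for `0 ≤ t ≤ Λ < r`,
`|∫_{(t,Λ]} N_K − ∫_{[−Λ,−t)} N_K| ≤ 4π·jacR·Λ·(Λ − t)`, `jacR = 1/(Dt_min − 2A)² + π√2(2 + 4A)/(Dt_min − 2A)³`. -/
theorem abs_integral_levelDensity_Ioc_sub_Ico_le {t Λ : ℝ} (ht : 0 ≤ t) (htΛ : t ≤ Λ) (hΛ : Λ < r) :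
    |(∫ ρ in Ioc t Λ, ∫ ϑ in Ioc 0 (2 * π), levelChartJac μ K (ρ, ϑ)) -
        ∫ ρ in Ico (-Λ) (-t), ∫ ϑ in Ioc 0 (2 * π), levelChartJac μ K (ρ, ϑ)| ≤
      4 * π * (1 / (B.Dtmin - 2 * A) ^ 2 + Real.pi * Real.sqrt 2 * (2 + 4 * A) / (B.Dtmin - 2 * A) ^ 3) * Λ * (Λ - t) := by
  set N : ℝ → ℝ := fun ρ => ∫ ϑ in Ioc 0 (2 * π), levelChartJac μ K (ρ, ϑ) with hN
  set jacR := 1 / (B.Dtmin - 2 * A) ^ 2 + Real.pi * Real.sqrt 2 * (2 + 4 * A) / (B.Dtmin - 2 * A) ^ 3 with hjacR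
  have hsub : Icc (-Λ) Λ ⊆ Ioo (-r) r := fun x hx => ⟨by linarith [hx.1], by linarith [hx.2]⟩
  have hcont : ContinuousOn N (Icc (-Λ) Λ) := (continuousOn_levelDensity B hA hADt hlo hhi).mono hsub
  have hcontneg : ContinuousOn (fun ρ => N (-ρ)) (Icc (-Λ) Λ) := by
    refine hcont.comp continuous_neg.continuousOn fun x hx => ?_
    exact ⟨by linarith [hx.2], by linarith [hx.1]⟩
  have hI1 : ∫ ρ in Ioc t Λ, N ρ = ∫ ρ in t..Λ, N ρ := (intervalIntegral.integral_of_le htΛ).symm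
  have hI2 : ∫ ρ in Ico (-Λ) (-t), N ρ = ∫ ρ in t..Λ, N (-ρ) := by
    rw [setIntegral_congr_set Ico_ae_eq_Ioc, ← intervalIntegral.integral_of_le (by linarith : -Λ ≤ -t),
      ← intervalIntegral.integral_comp_neg fun ρ => N ρ]
  have hint1 : IntervalIntegrable N volume t Λ :=
    (hcont.mono (Icc_subset_Icc (by linarith) le_rfl)).intervalIntegrable_of_Icc htΛ
  have hint2 : IntervalIntegrable (fun ρ => N (-ρ)) volume t Λ :=
    (hcontneg.mono (Icc_subset_Icc (by linarith) le_rfl)).intervalIntegrable_of_Icc htΛ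
  rw [hI1, hI2, ← intervalIntegral.integral_sub hint1 hint2]
  have hb : ∀ ρ ∈ Set.uIoc t Λ, ‖N ρ - N (-ρ)‖ ≤ 4 * π * jacR * Λ := by
    intro ρ hρ
    rw [Set.uIoc_of_le htΛ] at hρ
    have hρr : ρ ∈ Ioo (-r) r := ⟨by linarith [hρ.1], by linarith [hρ.2]⟩
    have h := abs_levelDensity_sub_neg_le B hA hADt hlo hhi ρ hρr
    rw [Real.norm_eq_abs]
    have hρabs : |ρ| ≤ Λ := abs_le.2 ⟨by linarith [hρ.1], hρ.2⟩
    have hj : 0 ≤ 4 * π * jacR := by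
      have := jacRadialConst_pos B hADt (le_trans (norm_nonneg _) (hA 0 0 (by norm_num)))
      rw [← hjacR] at this
      positivity
    calc |N ρ - N (-ρ)| ≤ 4 * π * jacR * |ρ| := h
      _ ≤ 4 * π * jacR * Λ := mul_le_mul_of_nonneg_left hρabs hj
  have h := intervalIntegral.norm_integral_le_of_norm_le_const hb
  rw [Real.norm_eq_abs, abs_of_nonneg (by linarith : (0:ℝ) ≤ Λ - t)] at h
  linarith

/-! ## §3 The planar frame band on `ℝ²`: continuity, periodicity, cell oscillation, level-set volumes of `[0, 2π)²` -/

omit B hA hADt hlo hhi in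
/-- The planar frame band `q ↦ e_K(q) = ε₀(q) − K(q) − μ` in the `ℝ × ℝ` chart is the §3-band of `…TwoShellLatticeCount`. -/
theorem frameLevel_coord_eq_planarBand (x y : ℝ) :
    frameLevel μ K (WithLp.toLp 2 ![x, y]) = sqDispersion ![x, y] + -K.eval ![x, y] - μ := by
  rw [frameLevel_toLp, frameShift_toLp]

omit B hA hADt hlo hhi in
/-- The planar frame band is continuous. -/
theorem continuous_frameLevel_coord' : Continuous fun q : ℝ × ℝ => frameLevel μ K (WithLp.toLp 2 ![q.1, q.2]) := by
  have hvec : Continuous fun x : ℝ × ℝ => (![x.1, x.2] : Fin 2 → ℝ) := by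
    refine continuous_pi fun i => ?_
    fin_cases i
    · simpa using continuous_fst
    · simpa using continuous_snd
  exact (contDiff_frameLevel μ K (n := 0)).continuous.comp ((PiLp.continuous_toLp 2 _).comp hvec)

omit B hA hADt hlo hhi in
/-- The planar frame band is `2π`-periodic in the first coordinate. -/
theorem frameLevel_coord_add_two_pi_fst (q : ℝ × ℝ) :
    frameLevel μ K (WithLp.toLp 2 ![q.1 + 2 * π, q.2]) = frameLevel μ K (WithLp.toLp 2 ![q.1, q.2]) := by
  rw [frameLevel_coord_eq_planarBand, frameLevel_coord_eq_planarBand]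
  have h0 := vec_add_two_pi_fst q (0 : Fin 2 → ℝ)
  simp only [sub_zero] at h0
  rw [show (![(q.1 + 2 * π, q.2).1, (q.1 + 2 * π, q.2).2] : Fin 2 → ℝ) = ![q.1 + 2 * π, q.2] from rfl, h0, planarBand_periodic]

omit B hA hADt hlo hhi in
/-- The planar frame band is `2π`-periodic in the second coordinate. -/
theorem frameLevel_coord_add_two_pi_snd (q : ℝ × ℝ) :
    frameLevel μ K (WithLp.toLp 2 ![q.1, q.2 + 2 * π]) = frameLevel μ K (WithLp.toLp 2 ![q.1, q.2]) := by
  rw [frameLevel_coord_eq_planarBand, frameLevel_coord_eq_planarBand]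
  have h0 := vec_add_two_pi_snd q (0 : Fin 2 → ℝ)
  simp only [sub_zero] at h0
  rw [show (![(q.1, q.2 + 2 * π).1, (q.1, q.2 + 2 * π).2] : Fin 2 → ℝ) = ![q.1, q.2 + 2 * π] from rfl, h0, planarBand_periodic]

omit B hADt hlo hhi in
/-- **Cell oscillation of the planar frame band**: on the cell `p_k̃ + [0, 2π/L)²`, `|e_K(q) − e_K(p_k̃)| ≤ (4 + 2A)·(2π/L)`
(sup-metric Lipschitz constant `4 + ‖Dδ_K‖ ≤ 4 + 2A`, `abs_planarBand_sub_le`; cell diameter `2π/L`, `dist_le_of_mem_cell`). -/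
theorem abs_frameLevel_coord_sub_le_of_mem_cell {L : ℕ} [NeZero L] (k : TorusSite 2 L) {q : ℝ × ℝ}
    (hq : q ∈ Ico (latticeMomentum L k 0) (latticeMomentum L k 0 + 2 * π / L) ×ˢ Ico (latticeMomentum L k 1) (latticeMomentum L k 1 + 2 * π / L)) :
    |frameLevel μ K (WithLp.toLp 2 ![q.1, q.2]) -
        frameLevel μ K (WithLp.toLp 2 ![(latticeMomentum L k 0, latticeMomentum L k 1).1, (latticeMomentum L k 0, latticeMomentum L k 1).2])| ≤
      (4 + 2 * A) * (2 * π / L) := by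
  have hκ : ∀ x : Fin 2 → ℝ, ‖fderiv ℝ (fun x : Fin 2 → ℝ => -K.eval x) x‖ ≤ 2 * A := fun x => by
    rw [← frameShift_toLp_eq_neg_eval]; exact norm_fderiv_frameShift_toLp_le hA x
  have h := abs_planarBand_sub_le hκ μ (0 : Fin 2 → ℝ) q (latticeMomentum L k 0, latticeMomentum L k 1)
  simp only [sub_zero] at h
  rw [frameLevel_coord_eq_planarBand, frameLevel_coord_eq_planarBand]
  have hA0 : 0 ≤ 4 + 2 * A := by linarith [le_trans (norm_nonneg _) (hA 0 0 (by norm_num))]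
  exact h.trans (mul_le_mul_of_nonneg_left (dist_le_of_mem_cell k hq) hA0)

/-- **Level-set volumes of the half-open square `[0, 2π)²`**: for a measurable `I ⊆ (−r, r)`,
`vol{q ∈ [0,2π)² : e_K(q) ∈ I} = ∫_{ρ ∈ I} N_K(ρ) dρ` (periodic window shift of part 2 §4 + §1). -/
theorem volume_sq_levelSet_eq_integral_levelDensity {I : Set ℝ} (hI : MeasurableSet I) (hIr : I ⊆ Ioo (-r) r) :
    volume {q ∈ Ico (0 : ℝ) (2 * π) ×ˢ Ico (0 : ℝ) (2 * π) | frameLevel μ K (WithLp.toLp 2 ![q.1, q.2]) ∈ I} =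
      ENNReal.ofReal (∫ ρ in I, ∫ ϑ in Ioc 0 (2 * π), levelChartJac μ K (ρ, ϑ)) := by
  rw [← volume_openSq_levelSet_eq_integral_levelDensity B hA hADt hlo hhi hI hIr]
  exact volume_sep_sq_eq_volume_openSq_of_periodic (P := fun q : ℝ × ℝ => frameLevel μ K (WithLp.toLp 2 ![q.1, q.2]) ∈ I)
    ((continuous_frameLevel_coord' (K := K) (μ := μ)).measurable hI)
    (fun q => by simp only [frameLevel_coord_add_two_pi_fst]) (fun q => by simp only [frameLevel_coord_add_two_pi_snd])

/-! ## §4 THE GEO BRICK O3: the lattice two-sided shell asymmetry of the frame band -/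

/-- **THE LATTICE SHELL ASYMMETRY OF THE FRAME BAND (cure (C′), brick O3).**  Under the C4a chart hypotheses (`B : BandBounds a b`, frame of
`C²` size `A` with `2A < Dt_min`, tube `(−r, r)` with `[μ − r − A, μ + r + A] ⊂ (a, b)`), for `0 ≤ Λ` with `Λ + (4 + 2A)·2π/L < r` and every
`t ∈ [0, Λ]`:
`|#{k̃ : t < e_K(p_k̃) ≤ Λ} − #{k̃ : −Λ ≤ e_K(p_k̃) < −t}| ≤ (L/2π)²·(4π·jacR·Λ² + 4·(2π·π√2/(Dt_min − 2A))·((4 + 2A)·2π/L))`,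
`jacR = 1/(Dt_min − 2A)² + π√2(2 + 4A)/(Dt_min − 2A)³` — DOS-slope × `Λ²L²` plus lattice rounding `∝ L`; the input `A` of
`klol_abs_sum_odd_le`. [cite: BenfattoGiulianiMastropietro2006, §2.4 (2.40)–(2.41)] [cite: FeldmanSalmhoferTrubowitz1998, App. B] -/
theorem abs_card_sub_card_frameShell_le {L : ℕ} [NeZero L] {Λ : ℝ} (hΛ0 : 0 ≤ Λ) (hΛr : Λ + (4 + 2 * A) * (2 * π / L) < r) :
    ∀ t ∈ Icc 0 Λ, |((univ.filter fun k : TorusSite 2 L => t < nambuXiCT L μ K k ∧ nambuXiCT L μ K k ≤ Λ).card : ℝ) -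
        ((univ.filter fun k : TorusSite 2 L => -Λ ≤ nambuXiCT L μ K k ∧ nambuXiCT L μ K k < -t).card : ℝ)| ≤
      ((L : ℝ) / (2 * π)) ^ 2 *
        (4 * π * (1 / (B.Dtmin - 2 * A) ^ 2 + Real.pi * Real.sqrt 2 * (2 + 4 * A) / (B.Dtmin - 2 * A) ^ 3) * Λ ^ 2 +
          4 * (2 * π * (π * Real.sqrt 2 / (B.Dtmin - 2 * A))) * ((4 + 2 * A) * (2 * π / L))) := by
  intro t ht
  have hπ := Real.pi_pos
  have hL : (0 : ℝ) < L := by exact_mod_cast Nat.pos_of_ne_zero (NeZero.ne L)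
  have hA0 : 0 ≤ A := le_trans (norm_nonneg _) (hA 0 0 (by norm_num))
  have hd : 0 < B.Dtmin - 2 * A := by linarith
  set δ := (4 + 2 * A) * (2 * π / L) with hδdef
  set D := 2 * π * (π * Real.sqrt 2 / (B.Dtmin - 2 * A)) with hDdef
  set jacR := 1 / (B.Dtmin - 2 * A) ^ 2 + Real.pi * Real.sqrt 2 * (2 + 4 * A) / (B.Dtmin - 2 * A) ^ 3 with hjacR
  have hδ0 : 0 ≤ δ := by positivity
  have hD0 : 0 ≤ D := by positivity
  have hjacR0 : 0 < jacR := jacRadialConst_pos B hADt hA0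
  set e : ℝ × ℝ → ℝ := fun q => frameLevel μ K (WithLp.toLp 2 ![q.1, q.2]) with hedef
  have hlat : ∀ k : TorusSite 2 L, nambuXiCT L μ K k = e (latticeMomentum L k 0, latticeMomentum L k 1) := by
    intro k
    rw [nambuXiCT_eq_frameLevel L μ K k, hedef]
    congr 2
    funext i; fin_cases i <;> rfl
  have hshell : ∀ a' b' : ℝ, -Λ - δ ≤ a' → a' ≤ b' → b' ≤ Λ + δ →
      volume {q ∈ Ico (0 : ℝ) (2 * π) ×ˢ Ico (0 : ℝ) (2 * π) | a' ≤ e q ∧ e q ≤ b'} ≤ ENNReal.ofReal (D * (b' - a')) := by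
    intro a' b' ha hab hb
    have hIr : Icc a' b' ⊆ Ioo (-r) r := fun x hx => ⟨by linarith [hx.1], by linarith [hx.2]⟩
    have hv := volume_sq_levelSet_eq_integral_levelDensity B hA hADt hlo hhi (I := Icc a' b') measurableSet_Icc hIr
    have hle := integral_levelDensity_le B hA hADt hlo hhi hab (subset_refl (Icc a' b')) hIr
    calc volume {q ∈ Ico (0 : ℝ) (2 * π) ×ˢ Ico (0 : ℝ) (2 * π) | a' ≤ e q ∧ e q ≤ b'}
        = ENNReal.ofReal (∫ ρ in Icc a' b', ∫ ϑ in Ioc 0 (2 * π), levelChartJac μ K (ρ, ϑ)) := hv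
      _ ≤ ENNReal.ofReal (D * (b' - a')) := ENNReal.ofReal_le_ofReal hle
  have hAc : ∀ t ∈ Icc 0 Λ, |(volume {q ∈ Ico (0 : ℝ) (2 * π) ×ˢ Ico (0 : ℝ) (2 * π) | t < e q ∧ e q ≤ Λ}).toReal -
      (volume {q ∈ Ico (0 : ℝ) (2 * π) ×ˢ Ico (0 : ℝ) (2 * π) | -Λ ≤ e q ∧ e q < -t}).toReal| ≤ 4 * π * jacR * Λ ^ 2 := by
    intro t ht
    have hΛr' : Λ < r := by linarith
    have h1r : Ioc t Λ ⊆ Ioo (-r) r := fun x hx => ⟨by linarith [hx.1, ht.1], by linarith [hx.2]⟩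
    have h2r : Ico (-Λ) (-t) ⊆ Ioo (-r) r := fun x hx => ⟨by linarith [hx.1], by linarith [hx.2, ht.1]⟩
    have hv1 := volume_sq_levelSet_eq_integral_levelDensity B hA hADt hlo hhi (I := Ioc t Λ) measurableSet_Ioc h1r
    have hv2 := volume_sq_levelSet_eq_integral_levelDensity B hA hADt hlo hhi (I := Ico (-Λ) (-t)) measurableSet_Ico h2r
    have hn1 : 0 ≤ ∫ ρ in Ioc t Λ, ∫ ϑ in Ioc 0 (2 * π), levelChartJac μ K (ρ, ϑ) :=
      setIntegral_nonneg measurableSet_Ioc fun ρ hρ => (levelDensity_nonneg_le B hA hADt hlo hhi (h1r hρ)).1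
    have hn2 : 0 ≤ ∫ ρ in Ico (-Λ) (-t), ∫ ϑ in Ioc 0 (2 * π), levelChartJac μ K (ρ, ϑ) :=
      setIntegral_nonneg measurableSet_Ico fun ρ hρ => (levelDensity_nonneg_le B hA hADt hlo hhi (h2r hρ)).1
    have e1 : (volume {q ∈ Ico (0 : ℝ) (2 * π) ×ˢ Ico (0 : ℝ) (2 * π) | t < e q ∧ e q ≤ Λ}).toReal =
        ∫ ρ in Ioc t Λ, ∫ ϑ in Ioc 0 (2 * π), levelChartJac μ K (ρ, ϑ) := by
      rw [show {q ∈ Ico (0 : ℝ) (2 * π) ×ˢ Ico (0 : ℝ) (2 * π) | t < e q ∧ e q ≤ Λ} =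
        {q ∈ Ico (0 : ℝ) (2 * π) ×ˢ Ico (0 : ℝ) (2 * π) | e q ∈ Ioc t Λ} from rfl, hv1, ENNReal.toReal_ofReal hn1]
    have e2 : (volume {q ∈ Ico (0 : ℝ) (2 * π) ×ˢ Ico (0 : ℝ) (2 * π) | -Λ ≤ e q ∧ e q < -t}).toReal =
        ∫ ρ in Ico (-Λ) (-t), ∫ ϑ in Ioc 0 (2 * π), levelChartJac μ K (ρ, ϑ) := by
      rw [show {q ∈ Ico (0 : ℝ) (2 * π) ×ˢ Ico (0 : ℝ) (2 * π) | -Λ ≤ e q ∧ e q < -t} =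
        {q ∈ Ico (0 : ℝ) (2 * π) ×ˢ Ico (0 : ℝ) (2 * π) | e q ∈ Ico (-Λ) (-t)} from rfl, hv2, ENNReal.toReal_ofReal hn2]
    rw [e1, e2]
    have h := abs_integral_levelDensity_Ioc_sub_Ico_le B hA hADt hlo hhi ht.1 ht.2 hΛr'
    have hmono : 4 * π * jacR * Λ * (Λ - t) ≤ 4 * π * jacR * Λ ^ 2 := by
      have : 4 * π * jacR * Λ * (Λ - t) = 4 * π * jacR * Λ ^ 2 - 4 * π * jacR * Λ * t := by ring
      rw [this]
      have : 0 ≤ 4 * π * jacR * Λ * t := by have := ht.1; positivity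
      linarith
    exact h.trans hmono
  have hmain := abs_card_sub_card_shell_le_of_volumes e hδ0 hD0
    (fun k q hq => abs_frameLevel_coord_sub_le_of_mem_cell hA k hq) hshell hAc t ht
  have hfilt₁ : (univ.filter fun k : TorusSite 2 L => t < nambuXiCT L μ K k ∧ nambuXiCT L μ K k ≤ Λ) =
      univ.filter fun k : TorusSite 2 L =>
        t < e (latticeMomentum L k 0, latticeMomentum L k 1) ∧ e (latticeMomentum L k 0, latticeMomentum L k 1) ≤ Λ :=
    Finset.filter_congr fun k _ => by rw [hlat k]
  have hfilt₂ : (univ.filter fun k : TorusSite 2 L => -Λ ≤ nambuXiCT L μ K k ∧ nambuXiCT L μ K k < -t) =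
      univ.filter fun k : TorusSite 2 L =>
        -Λ ≤ e (latticeMomentum L k 0, latticeMomentum L k 1) ∧ e (latticeMomentum L k 0, latticeMomentum L k 1) < -t :=
    Finset.filter_congr fun k _ => by rw [hlat k]
  rw [hfilt₁, hfilt₂]
  exact hmain

end Chart

end Summit.HubbardSuperconductivity.HubbardSuperconductivity.Theorems.EngineV8

end
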